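import Literature.NumberTheory.Sieve.SmoothMinorArcsCS
import Mathlib.NumberTheory.Harmonic.Bounds
import HarnessLib

/-!
# A crude Vinogradov-type bound for exponential sums over smooth numbers (large denominators)

Topic `Literature/NumberTheory/Sieve`; a PROVED tool file toward
`Literature.NumberTheory.DiophantineGeometry.XYZUpperHalf` ([Harper2016, Cor. 1]). In the proof of
Proposition 5 of op. cit. (§5) the range of large denominators `q` is handled by
Fouvry–Tenenbaum's bound `≪ x(1+|δx|) log³x (√y x^{−1/4} + q^{−1/2} + √(qy/x))`. We prove a
cruder substitute by the classical bilinear method, starting from the Cauchy–Schwarz reduction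
`norm_sum_smooth_fourierChar_le` and counting trivially afterwards:

* `le_distInt_mul_of_abs_le_mul` — if `|α − a/q| ≤ K₀/q²`, `(a,q) = 1`, `K₀ ≥ 1`, then
  `‖αm‖ ≥ 1/(2q)` for `0 < |m| ≤ q/(2K₀)` (Nathanson's Lemma 4.8 with a constant).
* `sum_geomBound_mul_le` — `∑_{1 ≤ h ≤ H} min(V, 1/(2‖αh‖)) ≤ (4K₀H/q + 1)(2V + 2q(1 + log q))`.
* `norm_smoothExpSum_le_crude` — for `θ = a/q + δ`, `(a,q) = 1`, `y|δ|q² ≤ K₀`, `1 ≤ K₀`, and a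
  free parameter `W₀` with `y ≤ W₀ ≤ x`:
  `|∑_{n ≤ x, n ∈ S(y)} e(nθ)| ≤ W₀ + 2(1 + log y) √(2x) ·
     √(10 W₀ y (1 + log y) + 32 K₀ x y/q + 16 K₀ x y² (1 + log q)/W₀ + 4 y q (1 + log q))`.

## References

* A. J. Harper, Compositio Math. 152 (2016) 1121–1158, §5 (proof of Proposition 5) [Harper2016].
* M. B. Nathanson, *Additive Number Theory: The Classical Bases*, GTM 164, §4.4 [Nathanson1996].
-/

noncomputable section

open Finset Real
open scoped FourierTransform
open Literature.NumberTheory.Sieve.Vinogradov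

namespace Literature.NumberTheory.Sieve

/-! ### Separation and the block estimate -/

/-- **Separation with a constant**: if `|α − a/q| ≤ K₀/q²` with `(a, q) = 1` and `K₀ ≥ 1`, then
`‖αm‖ ≥ 1/(2q)` for every integer `m` with `0 < |m| ≤ q/(2K₀)`.
[cite: Nathanson1996, §4.4, Lemma 4.8] -/
theorem le_distInt_mul_of_abs_le_mul {α K₀ : ℝ} {a : ℤ} {q : ℕ} (hq : 1 ≤ q) (hcop : IsCoprime a q)
    (hK₀ : 1 ≤ K₀) (hα : |α - a / q| ≤ K₀ / (q : ℝ) ^ 2) {m : ℤ} (hm0 : m ≠ 0)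
    (hm : |(m : ℝ)| ≤ q / (2 * K₀)) :
    1 / (2 * (q : ℝ)) ≤ distInt (α * m) := by
  have hq0 : (0 : ℝ) < q := by exact_mod_cast hq
  have hK0 : 0 < K₀ := by linarith
  have hmq : |(m : ℝ)| < q := by
    refine lt_of_le_of_lt hm ?_
    rw [div_lt_iff₀ (by positivity)]; nlinarith
  -- `q ∤ a m`
  have hndvd : ¬ ((q : ℤ) ∣ a * m) := by
    intro h
    have hqm : (q : ℤ) ∣ m := hcop.symm.dvd_of_dvd_mul_left h
    obtain ⟨c, hc⟩ := hqm
    have hc0 : c ≠ 0 := by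
      rintro rfl; simp at hc; exact hm0 hc
    have h1 : (1 : ℝ) ≤ |(c : ℝ)| := by exact_mod_cast Int.one_le_abs hc0
    have h2 : (q : ℝ) ≤ |(m : ℝ)| := by
      rw [hc]; push_cast; rw [abs_mul, abs_of_pos hq0]; nlinarith
    linarith
  -- `‖am/q‖ ≥ 1/q`
  have h1 : 1 / (q : ℝ) ≤ distInt (((a * m : ℤ) : ℝ) / q) := by
    unfold distInt
    set n := round (((a * m : ℤ) : ℝ) / q) with hn
    have hne : (a * m : ℤ) - n * q ≠ 0 := by
      intro h; apply hndvd; exact ⟨n, by linarith⟩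
    have h1' : (1 : ℝ) ≤ |(((a * m : ℤ) - n * q : ℤ) : ℝ)| := by exact_mod_cast Int.one_le_abs hne
    have heq : ((a * m : ℤ) : ℝ) / q - n = ((((a * m : ℤ) - n * q : ℤ)) : ℝ) / q := by
      push_cast; field_simp
    rw [heq, abs_div, abs_of_pos hq0]
    exact div_le_div_of_nonneg_right h1' hq0.le
  -- `|αm - am/q| ≤ 1/(2q)`
  have h2 : distInt (α * m - ((a * m : ℤ) : ℝ) / q) ≤ 1 / (2 * q) := by
    calc distInt (α * m - ((a * m : ℤ) : ℝ) / q)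
        ≤ |α * m - ((a * m : ℤ) : ℝ) / q - ((0 : ℤ) : ℝ)| := distInt_le_abs_sub_int _ 0
      _ = |α - a / q| * |(m : ℝ)| := by
          rw [← abs_mul]; congr 1; push_cast; ring
      _ ≤ K₀ / (q : ℝ) ^ 2 * (q / (2 * K₀)) := mul_le_mul hα hm (abs_nonneg _) (by positivity)
      _ = 1 / (2 * q) := by field_simp
  have h3 := distInt_sub_distInt_le (α * m) (((a * m : ℤ) : ℝ) / q)
  have h4 : 1 / (q : ℝ) - 1 / (2 * q) = 1 / (2 * q) := by field_simp; ring
  linarith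

/-- **The block estimate**: if `|α − a/q| ≤ K₀/q²` with `(a, q) = 1`, `K₀ ≥ 1`, then for `V ≥ 0`
and every `H`, `∑_{1 ≤ h ≤ H} min(V, 1/(2‖αh‖)) ≤ (4K₀H/q + 1)(2V + 2q(1 + log q))`
(blocks of `max(1, ⌊q/(2K₀)⌋)` consecutive integers; `sum_geomBound_le_of_separated` on each).
[cite: Nathanson1996, §4.4, Lemmas 4.8–4.11] -/
theorem sum_geomBound_mul_le {α K₀ V : ℝ} {a : ℤ} {q : ℕ} (hq : 1 ≤ q) (hcop : IsCoprime a q)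
    (hK₀ : 1 ≤ K₀) (hα : |α - a / q| ≤ K₀ / (q : ℝ) ^ 2) (hV : 0 ≤ V) (H : ℕ) :
    ∑ h ∈ Finset.Icc 1 H, geomBound V (α * h) ≤
      (4 * K₀ * H / q + 1) * (2 * V + 2 * q * (1 + Real.log q)) := by
  classical
  have hq0 : (0 : ℝ) < q := by exact_mod_cast hq
  have hK0 : 0 < K₀ := by linarith
  have hlogq : 0 ≤ Real.log q := Real.log_nonneg (by exact_mod_cast hq)
  set B : ℕ := max 1 ⌊(q : ℝ) / (2 * K₀)⌋₊ with hB
  have hB1 : 1 ≤ B := le_max_left _ _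
  have hB0 : 0 < B := hB1
  -- `B - 1 ≤ q/(2K₀)` and `B ≥ q/(4K₀)`
  have hBup : ((B : ℝ) - 1) ≤ q / (2 * K₀) := by
    rcases le_or_gt ⌊(q : ℝ) / (2 * K₀)⌋₊ 1 with h | h
    · have : B = 1 := by rw [hB]; exact max_eq_left h
      rw [this]; simp; positivity
    · have : B = ⌊(q : ℝ) / (2 * K₀)⌋₊ := by rw [hB]; exact max_eq_right h.le
      rw [this]
      have := Nat.floor_le (show 0 ≤ (q : ℝ) / (2 * K₀) by positivity)
      linarith
  have hBlo : (q : ℝ) / (4 * K₀) ≤ B := by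
    rcases le_or_gt ((q : ℝ) / (2 * K₀)) 2 with h | h
    · have h1 : (1 : ℝ) ≤ B := by exact_mod_cast hB1
      have : (q : ℝ) / (4 * K₀) ≤ 1 := by
        rw [div_le_one (by positivity)]; rw [div_le_iff₀ (by positivity)] at h; linarith
      linarith
    · have h1 : (⌊(q : ℝ) / (2 * K₀)⌋₊ : ℝ) ≤ B := by exact_mod_cast le_max_right _ _
      have h2 : (q : ℝ) / (2 * K₀) - 1 < ⌊(q : ℝ) / (2 * K₀)⌋₊ := Nat.sub_one_lt_floor _
      have h3 : (q : ℝ) / (4 * K₀) = (q : ℝ) / (2 * K₀) / 2 := by field_simp; ring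
      rw [h3]; linarith
  -- block index
  set g : ℕ → ℕ := fun h => (h - 1) / B with hg
  set I : ℕ := (H - 1) / B with hI
  have hmaps : ∀ h ∈ Finset.Icc 1 H, g h ∈ Finset.range (I + 1) := by
    intro h hh
    rw [Finset.mem_Icc] at hh
    rw [Finset.mem_range, Nat.lt_succ_iff, hg, hI]
    exact Nat.div_le_div_right (by omega)
  rw [← Finset.sum_fiberwise_of_maps_to hmaps]
  -- each block
  have hblock : ∀ i ∈ Finset.range (I + 1),
      ∑ h ∈ (Finset.Icc 1 H).filter (fun h => g h = i), geomBound V (α * h) ≤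
        2 * V + 2 * q * (1 + Real.log q) := by
    intro i _
    have hsep : ∀ h ∈ (Finset.Icc 1 H).filter (fun h => g h = i),
        ∀ h' ∈ (Finset.Icc 1 H).filter (fun h => g h = i), h ≠ h' →
        1 / (2 * (q : ℝ)) ≤ distInt (α * h - α * h') := by
      intro h hh h' hh' hne
      rw [Finset.mem_filter, Finset.mem_Icc, hg] at hh hh'
      -- `|h - h'| ≤ B - 1`
      have hdiff : |((h : ℤ) - h' : ℤ)| ≤ (B : ℤ) - 1 := by
        have h1 : (h - 1) / B = i := hh.2
        have h2 : (h' - 1) / B = i := hh'.2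
        have h3 := Nat.div_mul_le_self (h - 1) B
        have h4 := Nat.lt_div_mul_add (a := h - 1) hB0
        have h5 := Nat.div_mul_le_self (h' - 1) B
        have h6 := Nat.lt_div_mul_add (a := h' - 1) hB0
        rw [h1] at h3 h4; rw [h2] at h5 h6
        rw [abs_le]; constructor <;> omega
      have hne' : ((h : ℤ) - h' : ℤ) ≠ 0 := by
        intro h0; apply hne; omega
      have := le_distInt_mul_of_abs_le_mul hq hcop hK₀ hα hne' (by
        have h1 : (((|((h : ℤ) - h' : ℤ)| : ℤ)) : ℝ) ≤ (((B : ℤ) - 1 : ℤ) : ℝ) := by exact_mod_cast hdiff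
        have h2 : |(((h : ℤ) - h' : ℤ) : ℝ)| = (((|((h : ℤ) - h' : ℤ)| : ℤ)) : ℝ) := (Int.cast_abs).symm
        rw [h2]
        push_cast at h1 ⊢
        linarith)
      push_cast at this
      rwa [show α * ((h : ℝ) - h') = α * h - α * h' by ring] at this
    have := sum_geomBound_le_of_separated ((Finset.Icc 1 H).filter (fun h => g h = i))
      (fun h : ℕ => α * h) (δ := 1 / (2 * q)) (by positivity) (m := q)
      (by rw [show (1 : ℝ) / (2 * (1 / (2 * q))) = q by field_simp]) hsep hV
    calc ∑ h ∈ (Finset.Icc 1 H).filter (fun h => g h = i), geomBound V (α * h)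
        ≤ 2 * V + 1 / (1 / (2 * (q : ℝ))) * (1 + Real.log q) := this
      _ = 2 * V + 2 * q * (1 + Real.log q) := by rw [one_div_one_div]
  -- number of blocks
  have hIle : ((I : ℝ) + 1) ≤ 4 * K₀ * H / q + 1 := by
    have h1 : ((I : ℕ) : ℝ) * B ≤ H := by
      have : I * B ≤ H - 1 + 0 := by rw [hI]; exact (Nat.div_mul_le_self (H - 1) B).trans (by omega)
      have : ((I * B : ℕ) : ℝ) ≤ ((H - 1 : ℕ) : ℝ) := by exact_mod_cast (by omega : I * B ≤ H - 1)
      push_cast at this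
      have h' : ((H - 1 : ℕ) : ℝ) ≤ H := by exact_mod_cast Nat.sub_le H 1
      linarith
    have hB0r : (0 : ℝ) < B := by exact_mod_cast hB0
    have h2 : (I : ℝ) ≤ H / B := by rw [le_div_iff₀ hB0r]; exact h1
    have h3 : (H : ℝ) / B ≤ 4 * K₀ * H / q := by
      rw [div_le_div_iff₀ hB0r hq0]
      have hH0 : (0 : ℝ) ≤ H := Nat.cast_nonneg _
      have := mul_le_mul_of_nonneg_left hBlo (show 0 ≤ 4 * K₀ * H by positivity)
      calc (H : ℝ) * q = (4 * K₀ * H) * (q / (4 * K₀)) := by field_simp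
        _ ≤ (4 * K₀ * H) * B := this
    linarith
  have hpos : 0 ≤ 2 * V + 2 * q * (1 + Real.log q) := by positivity
  calc ∑ i ∈ Finset.range (I + 1), ∑ h ∈ (Finset.Icc 1 H).filter (fun h => g h = i), geomBound V (α * h)
      ≤ ∑ i ∈ Finset.range (I + 1), (2 * V + 2 * q * (1 + Real.log q)) := Finset.sum_le_sum hblock
    _ = ((I : ℝ) + 1) * (2 * V + 2 * q * (1 + Real.log q)) := by
        rw [Finset.sum_const, Finset.card_range, nsmul_eq_mul]; push_cast; ring
    _ ≤ (4 * K₀ * H / q + 1) * (2 * V + 2 * q * (1 + Real.log q)) :=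
        mul_le_mul_of_nonneg_right hIle hpos

/-! ### Trivial counting after the Cauchy–Schwarz reduction -/

/-- `∑_{p ≤ y prime} 1/p ≤ 1 + log y` (harmonic bound). [folklore] -/
theorem sum_primes_inv_le (y : ℕ) :
    ∑ p ∈ (Finset.range (y + 1)).filter Nat.Prime, (1 / (p : ℝ)) ≤ 1 + Real.log y := by
  rcases Nat.eq_zero_or_pos y with hy | hy
  · subst hy; simp [Finset.filter_singleton, Nat.not_prime_zero]
  calc ∑ p ∈ (Finset.range (y + 1)).filter Nat.Prime, (1 / (p : ℝ))
      ≤ ∑ p ∈ Finset.Icc 1 y, (1 / (p : ℝ)) := by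
        refine Finset.sum_le_sum_of_subset_of_nonneg (fun p hp => ?_) (fun _ _ _ => by positivity)
        rw [Finset.mem_filter, Finset.mem_range] at hp
        rw [Finset.mem_Icc]; exact ⟨hp.2.one_lt.le, by omega⟩
    _ ≤ 1 + Real.log y := by
        have := harmonic_le_one_add_log y
        rw [harmonic_eq_sum_Icc] at this
        push_cast at this
        simpa [one_div] using this

/-- Splitting `S(y) ∩ [1, x]` at `A ≤ x`. [folklore] -/
theorem smoothNumbersUpTo_eq_union {x A : ℝ} {k : ℕ} (hAx : A ≤ x) :
    Nat.smoothNumbersUpTo ⌊x⌋₊ k =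
      Nat.smoothNumbersUpTo ⌊A⌋₊ k ∪ (Finset.Ioc ⌊A⌋₊ ⌊x⌋₊).filter (· ∈ Nat.smoothNumbers k) := by
  have hfl : ⌊A⌋₊ ≤ ⌊x⌋₊ := Nat.floor_le_floor hAx
  ext n
  simp only [Finset.mem_union, Nat.mem_smoothNumbersUpTo, Finset.mem_filter, Finset.mem_Ioc]
  constructor
  · rintro ⟨h1, h2⟩
    rcases le_or_gt n ⌊A⌋₊ with h | h
    · exact Or.inl ⟨h, h2⟩
    · exact Or.inr ⟨⟨h, h1⟩, h2⟩
  · rintro (⟨h1, h2⟩ | ⟨⟨-, h1⟩, h2⟩)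
    · exact ⟨h1.trans hfl, h2⟩
    · exact ⟨h1, h2⟩

/-- Shifting: `∑_{1 ≤ n₁ ≤ N} min(V, 1/(2‖p(n₁−n₂)θ‖)) ≤ V + 2 ∑_{1 ≤ h ≤ N} min(V, 1/(2‖(pθ) h‖))`
for `1 ≤ n₂ ≤ N`. [folklore] -/
theorem sum_geomBound_shift_le {V β : ℝ} (hV : 0 ≤ V) {N n₂ : ℕ} (hn₂ : 1 ≤ n₂) (hn₂N : n₂ ≤ N) :
    ∑ n₁ ∈ Finset.Icc 1 N, geomBound V (β * ((n₁ : ℝ) - n₂)) ≤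
      V + 2 * ∑ h ∈ Finset.Icc 1 N, geomBound V (β * h) := by
  classical
  have hsplit : Finset.Icc 1 N = Finset.Ico 1 n₂ ∪ ({n₂} ∪ Finset.Ioc n₂ N) := by
    ext n; simp only [Finset.mem_Icc, Finset.mem_union, Finset.mem_Ico, Finset.mem_singleton,
      Finset.mem_Ioc]; omega
  have hd1 : Disjoint (Finset.Ico 1 n₂) ({n₂} ∪ Finset.Ioc n₂ N) := by
    rw [Finset.disjoint_left]; intro n hn hn'
    simp only [Finset.mem_Ico, Finset.mem_union, Finset.mem_singleton, Finset.mem_Ioc] at hn hn'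
    omega
  have hd2 : Disjoint ({n₂} : Finset ℕ) (Finset.Ioc n₂ N) := by
    rw [Finset.disjoint_left]; intro n hn hn'
    simp only [Finset.mem_singleton, Finset.mem_Ioc] at hn hn'; omega
  conv_lhs => rw [hsplit]
  rw [Finset.sum_union hd1, Finset.sum_union hd2, Finset.sum_singleton, sub_self, mul_zero,
    geomBound_zero]
  -- the part `n₁ < n₂`: `h = n₂ - n₁`
  have hlow : ∑ n₁ ∈ Finset.Ico 1 n₂, geomBound V (β * ((n₁ : ℝ) - n₂)) ≤
      ∑ h ∈ Finset.Icc 1 N, geomBound V (β * h) := by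
    have hinj : Set.InjOn (fun n₁ : ℕ => n₂ - n₁) ↑(Finset.Ico 1 n₂) := by
      intro a ha b hb hab
      simp only [Finset.coe_Ico, Set.mem_Ico] at ha hb
      simp only at hab; omega
    calc ∑ n₁ ∈ Finset.Ico 1 n₂, geomBound V (β * ((n₁ : ℝ) - n₂))
        = ∑ n₁ ∈ Finset.Ico 1 n₂, geomBound V (β * ((n₂ - n₁ : ℕ) : ℝ)) := by
          refine Finset.sum_congr rfl fun n₁ hn₁ => ?_
          rw [Finset.mem_Ico] at hn₁
          rw [Nat.cast_sub hn₁.2.le, show β * ((n₁ : ℝ) - n₂) = -(β * ((n₂ : ℝ) - n₁)) by ring,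
            geomBound_neg]
      _ = ∑ h ∈ (Finset.Ico 1 n₂).image (fun n₁ => n₂ - n₁), geomBound V (β * h) :=
          (Finset.sum_image (f := fun h : ℕ => geomBound V (β * h)) hinj).symm
      _ ≤ ∑ h ∈ Finset.Icc 1 N, geomBound V (β * h) := by
          refine Finset.sum_le_sum_of_subset_of_nonneg (fun h hh => ?_) (fun _ _ _ => geomBound_nonneg hV _)
          rw [Finset.mem_image] at hh
          obtain ⟨n₁, hn₁, rfl⟩ := hh
          rw [Finset.mem_Ico] at hn₁
          rw [Finset.mem_Icc]; omega
  -- the part `n₁ > n₂`: `h = n₁ - n₂`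
  have hhigh : ∑ n₁ ∈ Finset.Ioc n₂ N, geomBound V (β * ((n₁ : ℝ) - n₂)) ≤
      ∑ h ∈ Finset.Icc 1 N, geomBound V (β * h) := by
    have hinj : Set.InjOn (fun n₁ : ℕ => n₁ - n₂) ↑(Finset.Ioc n₂ N) := by
      intro a ha b hb hab
      simp only [Finset.coe_Ioc, Set.mem_Ioc] at ha hb
      simp only at hab; omega
    calc ∑ n₁ ∈ Finset.Ioc n₂ N, geomBound V (β * ((n₁ : ℝ) - n₂))
        = ∑ n₁ ∈ Finset.Ioc n₂ N, geomBound V (β * ((n₁ - n₂ : ℕ) : ℝ)) := by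
          refine Finset.sum_congr rfl fun n₁ hn₁ => ?_
          rw [Finset.mem_Ioc] at hn₁
          rw [Nat.cast_sub hn₁.1.le]
      _ = ∑ h ∈ (Finset.Ioc n₂ N).image (fun n₁ => n₁ - n₂), geomBound V (β * h) :=
          (Finset.sum_image (f := fun h : ℕ => geomBound V (β * h)) hinj).symm
      _ ≤ ∑ h ∈ Finset.Icc 1 N, geomBound V (β * h) := by
          refine Finset.sum_le_sum_of_subset_of_nonneg (fun h hh => ?_) (fun _ _ _ => geomBound_nonneg hV _)
          rw [Finset.mem_image] at hh
          obtain ⟨n₁, hn₁, rfl⟩ := hh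
          rw [Finset.mem_Ioc] at hn₁
          rw [Finset.mem_Icc]; omega
  linarith

set_option maxHeartbeats 3000000 in
-- a long assembly with a large context
/-- **A crude bound for large denominators** (substitute for Fouvry–Tenenbaum in Harper's
Proposition 5). Let `x ≥ 16`, `y ≥ 2`, `θ = a/q + δ` with `q ≥ 1`, `(a, q) = 1`, `1 ≤ K₀`,
`y |δ| q² ≤ K₀`, and let `W₀` be a parameter with `y ≤ W₀ ≤ x`. Then
`|∑_{n ≤ x, n ∈ S(y)} e(nθ)| ≤ W₀ + 2(1 + log y) √(2x) ·
   √(10 W₀ y (1 + log y) + 32 K₀ x y/q + 16 K₀ x y² (1 + log q)/W₀ + 4 y q (1 + log q))`.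
[cite: Harper2016, §5 (proof of Proposition 5, the range of large `q`)] -/
theorem norm_smoothExpSum_le_crude {x W₀ K₀ δ : ℝ} {y q : ℕ} {a : ℤ} (hx : 16 ≤ x) (hy : 2 ≤ y)
    (hq : 1 ≤ q) (hcop : IsCoprime a q) (hK₀ : 1 ≤ K₀) (hδ : (y : ℝ) * |δ| * (q : ℝ) ^ 2 ≤ K₀)
    (hyW : (y : ℝ) ≤ W₀) (hWx : W₀ ≤ x) :
    ‖∑ n ∈ Nat.smoothNumbersUpTo ⌊x⌋₊ (y + 1), (𝐞 ((n : ℝ) * ((a : ℝ) / q + δ)) : ℂ)‖ ≤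
      W₀ + 2 * (1 + Real.log y) * Real.sqrt (2 * x) *
        Real.sqrt (10 * W₀ * y * (1 + Real.log y) + 32 * K₀ * x * y / q +
          16 * K₀ * x * (y : ℝ) ^ 2 * (1 + Real.log q) / W₀ + 4 * y * q * (1 + Real.log q)) := by
  classical
  have hx0 : 0 < x := by linarith
  have hy2r : (2 : ℝ) ≤ y := by exact_mod_cast hy
  have hy0 : (0 : ℝ) < y := by linarith
  have hy1 : (1 : ℝ) ≤ y := by linarith
  have hlogy : 0 ≤ Real.log y := Real.log_nonneg hy1
  have hq0 : (0 : ℝ) < q := by exact_mod_cast hq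
  have hq1 : (1 : ℝ) ≤ q := by exact_mod_cast hq
  have hlogq : 0 ≤ Real.log q := Real.log_nonneg hq1
  have hW1 : 1 ≤ W₀ := by linarith
  have hW0 : 0 < W₀ := by linarith
  have hK0 : 0 < K₀ := by linarith
  set θ := (a : ℝ) / q + δ with hθ
  set Q₀ : ℝ := 10 * W₀ * y * (1 + Real.log y) + 32 * K₀ * x * y / q +
    16 * K₀ * x * (y : ℝ) ^ 2 * (1 + Real.log q) / W₀ + 4 * y * q * (1 + Real.log q) with hQ₀
  have hQ₀0 : 0 ≤ Q₀ := by positivity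
  -- ### split at `W₀`
  rw [smoothNumbersUpTo_eq_union hWx, Finset.sum_union (by
    rw [Finset.disjoint_left]
    intro n hn1 hn2
    rw [Nat.mem_smoothNumbersUpTo] at hn1
    rw [Finset.mem_filter, Finset.mem_Ioc] at hn2
    omega)]
  refine (norm_add_le _ _).trans (add_le_add ?_ ?_)
  · -- the short sum: at most `⌊W₀⌋ ≤ W₀` terms
    calc ‖∑ n ∈ Nat.smoothNumbersUpTo ⌊W₀⌋₊ (y + 1), (𝐞 ((n : ℝ) * θ) : ℂ)‖
        ≤ ∑ n ∈ Nat.smoothNumbersUpTo ⌊W₀⌋₊ (y + 1), ‖(𝐞 ((n : ℝ) * θ) : ℂ)‖ := norm_sum_le _ _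
      _ ≤ ∑ n ∈ Nat.smoothNumbersUpTo ⌊W₀⌋₊ (y + 1), (1 : ℝ) :=
          Finset.sum_le_sum fun n _ => (norm_fourierChar _).le
      _ = (Nat.smoothNumbersUpTo ⌊W₀⌋₊ (y + 1)).card := by rw [Finset.sum_const, nsmul_eq_mul, mul_one]
      _ ≤ ⌊W₀⌋₊ := by
          have hsub : Nat.smoothNumbersUpTo ⌊W₀⌋₊ (y + 1) ⊆ Finset.Icc 1 ⌊W₀⌋₊ := by
            intro n hn
            rw [Nat.mem_smoothNumbersUpTo] at hn
            rw [Finset.mem_Icc]; exact ⟨Nat.pos_of_ne_zero hn.2.1, hn.1⟩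
          have := Finset.card_le_card hsub
          rw [Nat.card_Icc] at this
          exact_mod_cast (by omega : (Nat.smoothNumbersUpTo ⌊W₀⌋₊ (y + 1)).card ≤ ⌊W₀⌋₊)
      _ ≤ W₀ := Nat.floor_le hW0.le
  -- ### the long sum
  have hCS := norm_sum_smooth_fourierChar_le (x := x) (A := W₀) (W := W₀) (θ := θ) (y := y)
    hW1 le_rfl hWx hy
  refine hCS.trans ?_
  set u₀ : ℕ := ⌊W₀⌋₊ + 1 with hu₀
  have hu₀W : W₀ < u₀ := by rw [hu₀]; push_cast; exact Nat.lt_floor_add_one W₀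
  have hu₀0 : 0 < u₀ := by rw [hu₀]; omega
  set P := (Finset.range (y + 1)).filter Nat.Prime with hP
  have hPmem : ∀ p ∈ P, p.Prime ∧ (p : ℝ) ≤ y := by
    intro p hp
    rw [hP, Finset.mem_filter, Finset.mem_range] at hp
    exact ⟨hp.2, by exact_mod_cast Nat.lt_succ_iff.mp hp.1⟩
  have hPcard : (P.card : ℝ) ≤ y := by
    have : P ⊆ Finset.Icc 2 y := by
      intro p hp
      rw [hP, Finset.mem_filter, Finset.mem_range] at hp
      rw [Finset.mem_Icc]; exact ⟨hp.2.two_le, by omega⟩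
    have h := Finset.card_le_card this
    rw [Nat.card_Icc] at h
    have : ((P.card : ℕ) : ℝ) ≤ ((y + 1 - 2 : ℕ) : ℝ) := by exact_mod_cast h
    refine this.trans ?_
    rw [Nat.cast_sub (by omega)]; push_cast; linarith
  have hsum_inv : ∑ p ∈ P, (1 / (p : ℝ)) ≤ 1 + Real.log y := sum_primes_inv_le y
  -- per class
  have hclass : ∀ j ∈ Finset.range (Nat.log 2 y + 1),
      Real.sqrt (((prefixSet y W₀).filter (fun m => Nat.log 2 (m / (⌊W₀⌋₊ + 1)) = j)).card : ℝ) *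
        Real.sqrt (∑ p ∈ P,
          ∑ n₁ ∈ Nat.smoothNumbersUpTo ⌊x / (((⌊W₀⌋₊ + 1) * 2 ^ j : ℕ) : ℝ)⌋₊ (y + 1),
          ∑ n₂ ∈ Nat.smoothNumbersUpTo ⌊x / (((⌊W₀⌋₊ + 1) * 2 ^ j : ℕ) : ℝ)⌋₊ (y + 1),
            geomBound ((((⌊W₀⌋₊ + 1) * 2 ^ j : ℕ) : ℝ) / p + 1) ((p : ℝ) * ((n₁ : ℝ) - n₂) * θ)) ≤
        Real.sqrt (2 * x) * Real.sqrt Q₀ := by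
    intro j _
    set Mj := (prefixSet y W₀).filter (fun m => Nat.log 2 (m / (⌊W₀⌋₊ + 1)) = j) with hMj
    set U : ℕ := (⌊W₀⌋₊ + 1) * 2 ^ j with hU
    rcases Mj.eq_empty_or_nonempty with hemp | ⟨m, hm⟩
    · rw [hemp, Finset.card_empty, Nat.cast_zero, Real.sqrt_zero, zero_mul]; positivity
    rw [hMj, Finset.mem_filter, mem_prefixSet hW0.le] at hm
    obtain ⟨⟨hmW, hmWy, -, -⟩, hmj⟩ := hm
    have hmu₀ : u₀ ≤ m := by
      have : ⌊W₀⌋₊ < m := (Nat.floor_lt hW0.le).mpr hmW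
      rw [hu₀]; omega
    have hUm : U ≤ m := by
      have h1 : 2 ^ j ≤ m / u₀ := by
        rw [← hmj, hu₀]; exact Nat.pow_log_le_self 2 (Nat.div_pos hmu₀ hu₀0).ne'
      calc U = u₀ * 2 ^ j := by rw [hU, hu₀]
        _ ≤ u₀ * (m / u₀) := Nat.mul_le_mul_left _ h1
        _ ≤ m := Nat.mul_div_le m u₀
    have hUlo : W₀ ≤ U := by
      have : (u₀ : ℝ) ≤ U := by
        rw [hU, hu₀]; push_cast
        have : (1 : ℝ) ≤ 2 ^ j := one_le_pow₀ (by norm_num)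
        nlinarith
      linarith
    have hUhi : (U : ℝ) ≤ W₀ * y := le_trans (by exact_mod_cast hUm) hmWy
    have hU0 : (0 : ℝ) < U := by linarith
    have hcard : (Mj.card : ℝ) ≤ 2 * U := by
      have hsub : Mj ⊆ Finset.range (2 * U) := by
        intro m' hm'
        rw [hMj, Finset.mem_filter, mem_prefixSet hW0.le] at hm'
        obtain ⟨⟨hm'W, -, -, -⟩, hm'j⟩ := hm'
        have hm'u₀ : u₀ ≤ m' := by
          have : ⌊W₀⌋₊ < m' := (Nat.floor_lt hW0.le).mpr hm'W
          rw [hu₀]; omega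
        have h2 : m' / u₀ < 2 ^ (j + 1) := by
          rw [← hm'j, hu₀]; exact Nat.lt_pow_succ_log_self one_lt_two _
        rw [Finset.mem_range]
        calc m' < u₀ * (m' / u₀ + 1) := by
              have := Nat.lt_div_mul_add (a := m') hu₀0
              linarith [Nat.div_add_mod m' u₀, Nat.mod_lt m' hu₀0]
          _ ≤ u₀ * 2 ^ (j + 1) := Nat.mul_le_mul_left _ h2
          _ = 2 * U := by rw [hU, hu₀, pow_succ]; ring
      have := Finset.card_le_card hsub
      rw [Finset.card_range] at this
      exact_mod_cast this
    -- trivial counting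
    set N : ℝ := x / U with hN
    have hN0 : 0 < N := by positivity
    set N' : ℕ := ⌊N⌋₊ with hN'
    have hN'N : (N' : ℝ) ≤ N := Nat.floor_le hN0.le
    set S := Nat.smoothNumbersUpTo N' (y + 1) with hS
    have hSsub : S ⊆ Finset.Icc 1 N' := by
      intro n hn
      rw [hS, Nat.mem_smoothNumbersUpTo] at hn
      rw [Finset.mem_Icc]; exact ⟨Nat.pos_of_ne_zero hn.2.1, hn.1⟩
    have hScard : (S.card : ℝ) ≤ N := by
      have := Finset.card_le_card hSsub
      rw [Nat.card_Icc] at this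
      calc (S.card : ℝ) ≤ N' := by exact_mod_cast (by omega : S.card ≤ N')
        _ ≤ N := hN'N
    have hper : ∀ p ∈ P, ∑ n₁ ∈ S, ∑ n₂ ∈ S, geomBound ((U : ℝ) / p + 1) ((p : ℝ) * ((n₁ : ℝ) - n₂) * θ) ≤
        N * (10 * U / p + 32 * K₀ * x / q + 16 * K₀ * N * p * (1 + Real.log q) + 4 * q * (1 + Real.log q)) := by
      intro p hp
      obtain ⟨hpP, hpy⟩ := hPmem p hp
      have hp0 : 0 < p := hpP.pos
      have hp0r : (0 : ℝ) < p := by exact_mod_cast hp0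
      have hpU : (p : ℝ) ≤ U := by linarith
      set V : ℝ := (U : ℝ) / p + 1 with hV
      have hV0 : 0 ≤ V := by positivity
      have hV2 : V ≤ 2 * U / p := by
        rw [hV, div_add_one hp0r.ne', div_le_div_iff_of_pos_right hp0r]; linarith
      -- the approximation of `pθ`
      set g := Nat.gcd p q with hg
      have hg0 : 0 < g := Nat.gcd_pos_of_pos_right p hq
      have hgp : g ∣ p := Nat.gcd_dvd_left p q
      have hgq : g ∣ q := Nat.gcd_dvd_right p q
      set r := q / g with hr
      set p' := p / g with hp'
      have hr0 : 0 < r := Nat.div_pos (Nat.le_of_dvd hq hgq) hg0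
      have hr1 : 1 ≤ r := hr0
      have hr0r : (0 : ℝ) < r := by exact_mod_cast hr0
      have hqrg : q = r * g := (Nat.div_mul_cancel hgq).symm
      have hprg : p = p' * g := (Nat.div_mul_cancel hgp).symm
      have hrq : (r : ℝ) ≤ q := by exact_mod_cast Nat.div_le_self q g
      have hgp_le : (g : ℝ) ≤ p := by exact_mod_cast Nat.le_of_dvd hp0 hgp
      have hqrp : (q : ℝ) ≤ r * p := by
        calc (q : ℝ) = r * g := by exact_mod_cast hqrg
          _ ≤ r * p := by gcongr
      have hpq : (p : ℝ) / q = p' / r := by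
        rw [div_eq_div_iff hq0.ne' hr0r.ne']
        have : (p : ℝ) * r = p' * q := by rw [hqrg, hprg]; push_cast; ring
        linarith
      have hcop' : IsCoprime ((p' : ℤ) * a) (r : ℤ) := by
        apply IsCoprime.mul_left
        · rw [Nat.isCoprime_iff_coprime, hp', hr, hg]
          exact Nat.coprime_div_gcd_div_gcd hg0
        · exact IsCoprime.of_isCoprime_of_dvd_right hcop (by exact_mod_cast (Dvd.intro _ hqrg.symm : r ∣ q))
      have happrox : |(p : ℝ) * θ - (((p' : ℤ) * a : ℤ) : ℝ) / r| ≤ K₀ / (r : ℝ) ^ 2 := by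
        have h1 : (p : ℝ) * θ - (((p' : ℤ) * a : ℤ) : ℝ) / r = p * δ := by
          rw [hθ]; push_cast
          rw [mul_add, show (p : ℝ) * ((a : ℝ) / q) = (p : ℝ) / q * a by ring, hpq]; ring
        rw [h1, abs_mul, abs_of_pos hp0r, le_div_iff₀ (by positivity)]
        calc (p : ℝ) * |δ| * (r : ℝ) ^ 2 ≤ y * |δ| * (q : ℝ) ^ 2 := by gcongr
          _ ≤ K₀ := hδ
      -- shift and apply the block estimate
      have hblock := sum_geomBound_mul_le (α := (p : ℝ) * θ) (V := V) hr1 hcop' hK₀ happrox hV0 N'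
      have hinner : ∀ n₂ ∈ S, ∑ n₁ ∈ S, geomBound V ((p : ℝ) * ((n₁ : ℝ) - n₂) * θ) ≤
          V + 2 * ((4 * K₀ * N' / r + 1) * (2 * V + 2 * r * (1 + Real.log r))) := by
        intro n₂ hn₂
        have hn₂' := hSsub hn₂
        rw [Finset.mem_Icc] at hn₂'
        calc ∑ n₁ ∈ S, geomBound V ((p : ℝ) * ((n₁ : ℝ) - n₂) * θ)
            ≤ ∑ n₁ ∈ Finset.Icc 1 N', geomBound V ((p : ℝ) * ((n₁ : ℝ) - n₂) * θ) :=
              Finset.sum_le_sum_of_subset_of_nonneg hSsub (fun _ _ _ => geomBound_nonneg hV0 _)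
          _ = ∑ n₁ ∈ Finset.Icc 1 N', geomBound V (((p : ℝ) * θ) * ((n₁ : ℝ) - n₂)) := by
              refine Finset.sum_congr rfl fun n₁ _ => ?_; ring_nf
          _ ≤ V + 2 * ∑ h ∈ Finset.Icc 1 N', geomBound V (((p : ℝ) * θ) * h) :=
              sum_geomBound_shift_le hV0 hn₂'.1 hn₂'.2
          _ ≤ V + 2 * ((4 * K₀ * N' / r + 1) * (2 * V + 2 * r * (1 + Real.log r))) := by
              gcongr
      have hlogr : Real.log r ≤ Real.log q := Real.log_le_log hr0r hrq
      have hlogr0 : 0 ≤ Real.log r := Real.log_nonneg (by exact_mod_cast hr1)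
      -- uniform bound for the bracket
      have hbr : V + 2 * ((4 * K₀ * N' / r + 1) * (2 * V + 2 * r * (1 + Real.log r))) ≤
          10 * U / p + 32 * K₀ * x / q + 16 * K₀ * N * p * (1 + Real.log q) + 4 * q * (1 + Real.log q) := by
        have h1 : (N' : ℝ) / r ≤ N * p / q := by
          rw [div_le_div_iff₀ hr0r hq0]
          calc (N' : ℝ) * q ≤ N * (r * p) := by gcongr
            _ = N * p * r := by ring
        have h2 : 4 * K₀ * N' / r ≤ 4 * K₀ * (N * p / q) := by
          rw [mul_div_assoc]; gcongr
        have hNU : N * U = x := by rw [hN]; field_simp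
        calc V + 2 * ((4 * K₀ * N' / r + 1) * (2 * V + 2 * r * (1 + Real.log r)))
            ≤ 2 * U / p + 2 * ((4 * K₀ * (N * p / q) + 1) * (2 * (2 * U / p) + 2 * q * (1 + Real.log q))) := by
              gcongr
          _ = 10 * U / p + 32 * K₀ * (N * U) / q + 16 * K₀ * N * p * (1 + Real.log q) +
                4 * q * (1 + Real.log q) := by
              field_simp; ring
          _ = _ := by rw [hNU]
      calc ∑ n₁ ∈ S, ∑ n₂ ∈ S, geomBound V ((p : ℝ) * ((n₁ : ℝ) - n₂) * θ)
          = ∑ n₂ ∈ S, ∑ n₁ ∈ S, geomBound V ((p : ℝ) * ((n₁ : ℝ) - n₂) * θ) := Finset.sum_comm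
        _ ≤ ∑ n₂ ∈ S, (10 * U / p + 32 * K₀ * x / q + 16 * K₀ * N * p * (1 + Real.log q) +
              4 * q * (1 + Real.log q)) :=
            Finset.sum_le_sum fun n₂ hn₂ => (hinner n₂ hn₂).trans hbr
        _ = S.card * _ := by rw [Finset.sum_const, nsmul_eq_mul]
        _ ≤ N * _ := by
            apply mul_le_mul_of_nonneg_right hScard
            positivity
    -- sum over primes
    have hsumP : ∑ p ∈ P, ∑ n₁ ∈ S, ∑ n₂ ∈ S, geomBound ((U : ℝ) / p + 1) ((p : ℝ) * ((n₁ : ℝ) - n₂) * θ) ≤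
        N * (10 * U * (1 + Real.log y) + 32 * K₀ * x * y / q + 16 * K₀ * N * (y : ℝ) ^ 2 * (1 + Real.log q) +
          4 * y * q * (1 + Real.log q)) := by
      have h1 : ∀ p ∈ P, (p : ℝ) ≤ y := fun p hp => (hPmem p hp).2
      set Bc : ℝ := 32 * K₀ * x / q with hBc
      set Cc : ℝ := 16 * K₀ * N * (1 + Real.log q) with hCc
      set Dc : ℝ := 4 * q * (1 + Real.log q) with hDc
      have hBc0 : 0 ≤ Bc := by positivity
      have hCc0 : 0 ≤ Cc := by positivity
      have hDc0 : 0 ≤ Dc := by positivity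
      have hre : ∀ p ∈ P, N * (10 * U / p + 32 * K₀ * x / q + 16 * K₀ * N * p * (1 + Real.log q) +
          4 * q * (1 + Real.log q)) = (N * (10 * U)) * (1 / (p : ℝ)) + (N * Cc) * (p : ℝ) + N * (Bc + Dc) := by
        intro p _; rw [hBc, hCc, hDc]; ring
      have hsp : ∑ p ∈ P, (p : ℝ) ≤ y * y := by
        calc ∑ p ∈ P, (p : ℝ) ≤ ∑ p ∈ P, (y : ℝ) := Finset.sum_le_sum h1
          _ = P.card * y := by rw [Finset.sum_const, nsmul_eq_mul]
          _ ≤ y * y := by gcongr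
      calc ∑ p ∈ P, ∑ n₁ ∈ S, ∑ n₂ ∈ S, geomBound ((U : ℝ) / p + 1) ((p : ℝ) * ((n₁ : ℝ) - n₂) * θ)
          ≤ ∑ p ∈ P, N * (10 * U / p + 32 * K₀ * x / q + 16 * K₀ * N * p * (1 + Real.log q) +
              4 * q * (1 + Real.log q)) := Finset.sum_le_sum hper
        _ = (N * (10 * U)) * ∑ p ∈ P, (1 / (p : ℝ)) + (N * Cc) * ∑ p ∈ P, (p : ℝ) + P.card * (N * (Bc + Dc)) := by
            rw [Finset.sum_congr rfl hre, Finset.sum_add_distrib, Finset.sum_add_distrib, ← Finset.mul_sum,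
              ← Finset.mul_sum, Finset.sum_const, nsmul_eq_mul]
        _ ≤ (N * (10 * U)) * (1 + Real.log y) + (N * Cc) * (y * y) + y * (N * (Bc + Dc)) := by
            gcongr
        _ = N * (10 * U * (1 + Real.log y) + 32 * K₀ * x * y / q + 16 * K₀ * N * (y : ℝ) ^ 2 * (1 + Real.log q) +
              4 * y * q * (1 + Real.log q)) := by rw [hBc, hCc, hDc]; ring
    -- `U ≤ W₀ y`, `N ≤ x / W₀`, `N U = x`
    have hNW : N ≤ x / W₀ := by
      rw [hN]; exact div_le_div_of_nonneg_left hx0.le hW0 hUlo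
    have hNU : N * U = x := by rw [hN]; field_simp
    have hbig : 2 * (U : ℝ) * (N * (10 * U * (1 + Real.log y) + 32 * K₀ * x * y / q +
        16 * K₀ * N * (y : ℝ) ^ 2 * (1 + Real.log q) + 4 * y * q * (1 + Real.log q))) ≤ 2 * x * Q₀ := by
      rw [show 2 * (U : ℝ) * (N * (10 * U * (1 + Real.log y) + 32 * K₀ * x * y / q +
          16 * K₀ * N * (y : ℝ) ^ 2 * (1 + Real.log q) + 4 * y * q * (1 + Real.log q))) =
        2 * (N * U) * (10 * U * (1 + Real.log y) + 32 * K₀ * x * y / q +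
          16 * K₀ * N * (y : ℝ) ^ 2 * (1 + Real.log q) + 4 * y * q * (1 + Real.log q)) by ring, hNU, hQ₀]
      have h1 : 10 * (U : ℝ) * (1 + Real.log y) ≤ 10 * W₀ * y * (1 + Real.log y) := by
        have : (U : ℝ) ≤ W₀ * y := hUhi
        have h0 : 0 ≤ 1 + Real.log y := by linarith
        nlinarith
      have h2 : 16 * K₀ * N * (y : ℝ) ^ 2 * (1 + Real.log q) ≤ 16 * K₀ * x * (y : ℝ) ^ 2 * (1 + Real.log q) / W₀ := by
        rw [le_div_iff₀ hW0]
        have : N * W₀ ≤ x := by rwa [le_div_iff₀ hW0] at hNW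
        have h0 : 0 ≤ 16 * K₀ * (y : ℝ) ^ 2 * (1 + Real.log q) := by positivity
        nlinarith
      gcongr 2 * x * (?_ + _ + ?_ + _)
    calc Real.sqrt (Mj.card : ℝ) * Real.sqrt (∑ p ∈ P, ∑ n₁ ∈ S, ∑ n₂ ∈ S,
          geomBound ((U : ℝ) / p + 1) ((p : ℝ) * ((n₁ : ℝ) - n₂) * θ))
        ≤ Real.sqrt (2 * U) * Real.sqrt (N * (10 * U * (1 + Real.log y) + 32 * K₀ * x * y / q +
            16 * K₀ * N * (y : ℝ) ^ 2 * (1 + Real.log q) + 4 * y * q * (1 + Real.log q))) :=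
          mul_le_mul (Real.sqrt_le_sqrt hcard) (Real.sqrt_le_sqrt hsumP) (Real.sqrt_nonneg _)
            (Real.sqrt_nonneg _)
      _ = Real.sqrt (2 * U * (N * (10 * U * (1 + Real.log y) + 32 * K₀ * x * y / q +
            16 * K₀ * N * (y : ℝ) ^ 2 * (1 + Real.log q) + 4 * y * q * (1 + Real.log q)))) :=
          (Real.sqrt_mul (by positivity) _).symm
      _ ≤ Real.sqrt (2 * x * Q₀) := Real.sqrt_le_sqrt hbig
      _ = Real.sqrt (2 * x) * Real.sqrt Q₀ := Real.sqrt_mul (by positivity) _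
  -- sum over `j`
  have hJ : ((Nat.log 2 y : ℕ) : ℝ) + 1 ≤ 2 * (1 + Real.log y) := by
    have h1 : (2 : ℝ) ^ (Nat.log 2 y) ≤ y := by exact_mod_cast Nat.pow_log_le_self 2 (by omega)
    have h2 : (Nat.log 2 y : ℝ) * Real.log 2 ≤ Real.log y := by
      rw [← Real.log_pow]; exact Real.log_le_log (by positivity) h1
    have hl2 : (1 : ℝ) / 2 < Real.log 2 := by have := Real.log_two_gt_d9; linarith
    nlinarith
  refine (Finset.sum_le_sum hclass).trans ?_
  rw [Finset.sum_const, Finset.card_range, nsmul_eq_mul]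
  push_cast
  calc (((Nat.log 2 y : ℕ) : ℝ) + 1) * (Real.sqrt (2 * x) * Real.sqrt Q₀)
      ≤ (2 * (1 + Real.log y)) * (Real.sqrt (2 * x) * Real.sqrt Q₀) :=
        mul_le_mul_of_nonneg_right hJ (by positivity)
    _ = 2 * (1 + Real.log y) * Real.sqrt (2 * x) * Real.sqrt Q₀ := by ring

end Literature.NumberTheory.Sieve

end
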